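import Literature.NumberTheory.Transcendental.KZLogCalculusProofs
import Literature.NumberTheory.Transcendental.KZSemialgebraicComplex
import Literature.NumberTheory.Transcendental.KZDominatedFamilyRelations
import Literature.ModelTheory.ExponentialFields.SemialgebraicComponents
import Summits.KontsevichZagierPeriods.KontsevichZagierPeriods.Theorems.LiouvilleUnfoldingLogPrimitiveNLStubDescentCells
import Summits.KontsevichZagierPeriods.KontsevichZagierPeriods.Theorems.LiouvilleUnfoldingLogPrimitiveNLStubDescentIntegrateBack
import Summits.KontsevichZagierPeriods.KontsevichZagierPeriods.Theorems.LiouvilleUnfoldingLogPrimitiveNLStubDescentStep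

/-!
# `LogPrimitiveNL` (stmt-KontsevichZagierPeriods-2836), line `logderiv-peeling`, stub `stub_descent` —
part 4: the Kolchin–Ostrowski induction

Lead's stub. `stub_descent : PeelingStep → ConstRigidity → LogLinearDescent` (registered signature),
by induction on the number `k` of logarithms: on the co-null open smooth locus of the data split
`{h_k ≠ 0}` (step A: normalise by the pivot, peel in each base direction with `PeelingStep`, apply the
induction hypothesis to the `n` peeled identities, refine, integrate back, const-rigidity on each
piece — `descent_stepA`) from the interior of `{h_k = 0}` (step B: the induction hypothesis directly,
lattice vectors extended by `0` — `descent_stepB`); frontiers and singular loci are null.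
-/

noncomputable section

open Set MeasureTheory
open scoped ContDiff
open Literature.NumberTheory.Transcendental Literature.ModelTheory.ExponentialFields

namespace Summit.KontsevichZagierPeriods.LiouvilleUnfolding.LogPrimitiveNL

/-! ### Step A: the pivot does not vanish -/

/-- **Step A of the descent.** On an open `ℚ`-semialgebraic `A` carrying differentiable data with
non-vanishing pivot `h_k`, the structure theorem for `k + 1` logarithms follows from the induction
hypothesis for `k` logarithms, the peeling step and constant-coefficient rigidity. [folklore] -/
theorem descent_stepA {n k : ℕ} (hPeel : (∀ (n k : ℕ) (U : Set (Fin n → ℝ)) (φ W : Fin k → (Fin n → ℝ) → ℝ) (P γ : (Fin n → ℝ) → ℝ)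
      (j : Fin n), IsSemialgebraic ℚ U → IsOpen U → (∀ i, IsSemialgebraicFunOn ℚ U (φ i)) →
      (∀ i, DifferentiableOn ℝ (φ i) U) → (∀ i, IsSemialgebraicFunOn ℚ U (W i)) →
      (∀ i, DifferentiableOn ℝ (W i) U) → (∀ i, ∀ x ∈ U, 0 < W i x) → IsSemialgebraicFunOn ℚ U P →
      DifferentiableOn ℝ P U → (∀ x ∈ U, 0 < P x) → IsSemialgebraicFunOn ℚ U γ →
      DifferentiableOn ℝ γ U → (∀ x ∈ U, ∑ i, φ i x * Real.log (W i x) + Real.log (P x) = γ x) →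
      (∀ i, IsSemialgebraicFunOn ℚ U (fun x => fderiv ℝ (φ i) x (Pi.single j (1 : ℝ)))) ∧
      IsSemialgebraicFunOn ℚ U (fun x => fderiv ℝ γ x (Pi.single j (1 : ℝ)) -
        ∑ i, φ i x * fderiv ℝ (W i) x (Pi.single j (1 : ℝ)) / W i x -
        fderiv ℝ P x (Pi.single j (1 : ℝ)) / P x) ∧
      (∀ x ∈ U, ∑ i, fderiv ℝ (φ i) x (Pi.single j (1 : ℝ)) * Real.log (W i x) =
        fderiv ℝ γ x (Pi.single j (1 : ℝ)) -
        ∑ i, φ i x * fderiv ℝ (W i) x (Pi.single j (1 : ℝ)) / W i x -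
        fderiv ℝ P x (Pi.single j (1 : ℝ)) / P x))) (hConst : (∀ (n k : ℕ) (D : Set (Fin n → ℝ)) (c : Fin k → ℝ) (W : Fin k → (Fin n → ℝ) → ℝ)
      (G : (Fin n → ℝ) → ℝ), IsSemialgebraic ℚ D → IsOpen D → (∀ i, IsAlgebraic ℚ (c i)) →
      (∀ i, IsSemialgebraicFunOn ℚ D (W i)) → (∀ i, ContinuousOn (W i) D) →
      (∀ i, ∀ x ∈ D, 0 < W i x) → IsSemialgebraicFunOn ℚ D G → ContinuousOn G D →
      (∀ x ∈ D, ∑ i, c i * Real.log (W i x) = G x) →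
      (∀ x ∈ D, G x = 0) ∧ ∃ (R : ℕ) (f : Fin R → Fin k → ℤ) (β : Fin R → ℝ),
        (∀ r, IsAlgebraic ℚ (β r)) ∧ (∀ r, ∀ x ∈ D, ∏ i, W i x ^ (f r i) = 1) ∧
        (∀ i, c i = ∑ r, β r * (f r i : ℝ))))
    (ih : ∀ (U' : Set (Fin n → ℝ)) (h' W' : Fin k → (Fin n → ℝ) → ℝ) (g' : (Fin n → ℝ) → ℝ),
      IsSemialgebraic ℚ U' → (∀ i, IsSemialgebraicFunOn ℚ U' (h' i)) →
      (∀ i, IsSemialgebraicFunOn ℚ U' (W' i)) → (∀ i, ∀ x ∈ U', 0 < W' i x) →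
      IsSemialgebraicFunOn ℚ U' g' → (∀ x ∈ U', ∑ i, h' i x * Real.log (W' i x) = g' x) →
      ∃ (N : ℕ) (C : Fin N → Set (Fin n → ℝ)),
        (∀ c, IsSemialgebraic ℚ (C c) ∧ IsOpen (C c) ∧ C c ⊆ U') ∧
        Pairwise (Function.onFun Disjoint C) ∧ volume (U' \ ⋃ c, C c) = 0 ∧
        ∀ c, (∀ x ∈ C c, g' x = 0) ∧
          ∃ (R : ℕ) (f : Fin R → Fin (k) → ℤ) (q : Fin R → (Fin n → ℝ) → ℝ),
            (∀ r, IsSemialgebraicFunOn ℚ (C c) (q r)) ∧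
            (∀ r, ∀ x ∈ C c, ∏ i, W' i x ^ (f r i) = 1) ∧
            (∀ i, ∀ x ∈ C c, h' i x = ∑ r, q r x * (f r i : ℝ)))
    {A : Set (Fin n → ℝ)} (hA : IsSemialgebraic ℚ A) (hAo : IsOpen A)
    {h W : Fin (k + 1) → (Fin n → ℝ) → ℝ} {g : (Fin n → ℝ) → ℝ}
    (hh : ∀ i, IsSemialgebraicFunOn ℚ A (h i)) (hhd : ∀ i, DifferentiableOn ℝ (h i) A)
    (hW : ∀ i, IsSemialgebraicFunOn ℚ A (W i)) (hWd : ∀ i, DifferentiableOn ℝ (W i) A)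
    (hWpos : ∀ i, ∀ x ∈ A, 0 < W i x) (hg : IsSemialgebraicFunOn ℚ A g)
    (hgd : DifferentiableOn ℝ g A) (hpiv : ∀ x ∈ A, h (Fin.last k) x ≠ 0)
    (hrel : ∀ x ∈ A, ∑ i, h i x * Real.log (W i x) = g x) :
    ∃ (N : ℕ) (C : Fin N → Set (Fin n → ℝ)),
        (∀ c, IsSemialgebraic ℚ (C c) ∧ IsOpen (C c) ∧ C c ⊆ A) ∧
        Pairwise (Function.onFun Disjoint C) ∧ volume (A \ ⋃ c, C c) = 0 ∧
        ∀ c, (∀ x ∈ C c, g x = 0) ∧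
          ∃ (R : ℕ) (f : Fin R → Fin (k + 1) → ℤ) (q : Fin R → (Fin n → ℝ) → ℝ),
            (∀ r, IsSemialgebraicFunOn ℚ (C c) (q r)) ∧
            (∀ r, ∀ x ∈ C c, ∏ i, W i x ^ (f r i) = 1) ∧
            (∀ i, ∀ x ∈ C c, h i x = ∑ r, q r x * (f r i : ℝ)) := by
  classical
  -- normalised data
  set hl : (Fin n → ℝ) → ℝ := h (Fin.last k) with hhl_def
  set φ : Fin k → (Fin n → ℝ) → ℝ := fun i x => h (Fin.castSucc i) x / hl x with hφ_def
  set W' : Fin k → (Fin n → ℝ) → ℝ := fun i => W (Fin.castSucc i) with hW'_def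
  set P : (Fin n → ℝ) → ℝ := W (Fin.last k) with hP_def
  set γ : (Fin n → ℝ) → ℝ := fun x => g x / hl x with hγ_def
  have hφ_sa : ∀ i, IsSemialgebraicFunOn ℚ A (φ i) := fun i => (hh _).div (hh _) hpiv
  have hφ_d : ∀ i, DifferentiableOn ℝ (φ i) A := fun i =>
    ((hhd (Fin.castSucc i)).mul ((hhd (Fin.last k)).inv hpiv)).congr fun x _ => by
      simp only [hφ_def, hhl_def, Pi.mul_apply, Pi.inv_apply, div_eq_mul_inv]
  have hW'_sa : ∀ i, IsSemialgebraicFunOn ℚ A (W' i) := fun i => hW _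
  have hW'_d : ∀ i, DifferentiableOn ℝ (W' i) A := fun i => hWd _
  have hW'pos : ∀ i, ∀ x ∈ A, 0 < W' i x := fun i => hWpos _
  have hγ_sa : IsSemialgebraicFunOn ℚ A γ := hg.div (hh _) hpiv
  have hγ_d : DifferentiableOn ℝ γ A :=
    (hgd.mul ((hhd (Fin.last k)).inv hpiv)).congr fun x _ => by
      simp only [hγ_def, hhl_def, Pi.mul_apply, Pi.inv_apply, div_eq_mul_inv]
  have hrel' : ∀ x ∈ A, ∑ i, φ i x * Real.log (W' i x) + Real.log (P x) = γ x := by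
    intro x hx
    have hx0 : hl x ≠ 0 := hpiv x hx
    have h1 := hrel x hx
    rw [Fin.sum_univ_castSucc] at h1
    simp only [hφ_def, hW'_def, hP_def, hγ_def]
    rw [eq_div_iff hx0, add_mul, Finset.sum_mul, ← h1]
    congr 1
    · exact Finset.sum_congr rfl fun i _ => by field_simp
    · simp only [hhl_def]
      ring
  -- peel in every base direction and apply the induction hypothesis
  have hIH : ∀ j : Fin n,
      ∃ (N : ℕ) (C : Fin N → Set (Fin n → ℝ)),
        (∀ c, IsSemialgebraic ℚ (C c) ∧ IsOpen (C c) ∧ C c ⊆ A) ∧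
        Pairwise (Function.onFun Disjoint C) ∧ volume (A \ ⋃ c, C c) = 0 ∧
        ∀ c, (∀ x ∈ C c, (fun x => fderiv ℝ γ x (Pi.single j (1 : ℝ)) - ∑ i, φ i x * fderiv ℝ (W' i) x (Pi.single j (1 : ℝ)) / W' i x - fderiv ℝ P x (Pi.single j (1 : ℝ)) / P x) x = 0) ∧
          ∃ (R : ℕ) (f : Fin R → Fin (k) → ℤ) (q : Fin R → (Fin n → ℝ) → ℝ),
            (∀ r, IsSemialgebraicFunOn ℚ (C c) (q r)) ∧
            (∀ r, ∀ x ∈ C c, ∏ i, W' i x ^ (f r i) = 1) ∧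
            (∀ i, ∀ x ∈ C c, (fun i x => fderiv ℝ (φ i) x (Pi.single j (1 : ℝ))) i x = ∑ r, q r x * (f r i : ℝ)) := by
    intro j
    obtain ⟨hdφ, hγj, hrelj⟩ := hPeel n k A φ W' P γ j hA hAo hφ_sa hφ_d hW'_sa hW'_d hW'pos
      (hW _) (hWd _) (hWpos _) hγ_sa hγ_d hrel'
    exact ih A _ W' _ hA hdφ hW'_sa hW'pos hγj hrelj
  choose N C hC hCdisj hCnull hCcell using hIH
  choose R f q hq hfW hφf using fun j c => (hCcell j c).2
  -- common refinement
  obtain ⟨hRcell, hRdisj, hRnull⟩ := descent_refine hA hAo C hC hCdisj hCnull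
  -- integrate back on every refined cell
  have hIB : ∀ κ : (j : Fin n) → Fin (N j), ∃ (N' : ℕ) (E : Fin N' → Set (Fin n → ℝ)),
      (∀ e, IsSemialgebraic ℚ (E e) ∧ IsOpen (E e) ∧ E e ⊆ A ∩ ⋂ j, C j (κ j)) ∧
      Pairwise (Function.onFun Disjoint E) ∧ (⋃ e, E e) = A ∩ ⋂ j, C j (κ j) ∧
      ∀ e, ∃ (v : Fin k → ℝ) (qq : (Σ j, Fin (R j (κ j))) → (Fin n → ℝ) → ℝ),
        (∀ i, IsAlgebraic ℚ (v i)) ∧ (∀ t, IsSemialgebraicFunOn ℚ (E e) (qq t)) ∧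
        ∀ i, ∀ x ∈ E e, φ i x = v i + ∑ t, qq t x * (f t.1 (κ t.1) t.2 i : ℝ) := by
    intro κ
    obtain ⟨hs, ho, hsub, hsubj⟩ := hRcell κ
    refine descent_integrateBack (T := Σ j, Fin (R j (κ j))) n k (A ∩ ⋂ j, C j (κ j)) φ
      (fun t => f t.1 (κ t.1) t.2) hs ho (fun i => (hφ_sa i).mono hsub hs)
      (fun i => (hφ_d i).mono hsub) fun j x hx => ?_
    refine ⟨fun t => if t.1 = j then q t.1 (κ t.1) t.2 x else 0, fun i => ?_⟩
    have hφfx := hφf j (κ j) i x (hsubj j hx)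
    dsimp only at hφfx
    rw [hφfx,
      Fintype.sum_sigma (fun t : Σ j, Fin (R j (κ j)) =>
        (if t.1 = j then q t.1 (κ t.1) t.2 x else 0) * (f t.1 (κ t.1) t.2 i : ℝ))]
    rw [Finset.sum_eq_single j]
    · simp
    · intro j' _ hj'
      simp [hj']
    · simp
  choose N' E hE hEdisj hEcov hEstruct using hIB
  -- on each piece, the structure for `k + 1` logarithms
  have hpiece : ∀ (κ : (j : Fin n) → Fin (N j)) (e : Fin (N' κ)), (∀ x ∈ E κ e, g x = 0) ∧
      ∃ (R : ℕ) (f : Fin R → Fin (k + 1) → ℤ) (q : Fin R → (Fin n → ℝ) → ℝ),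
            (∀ r, IsSemialgebraicFunOn ℚ (E κ e) (q r)) ∧
            (∀ r, ∀ x ∈ E κ e, ∏ i, W i x ^ (f r i) = 1) ∧
            (∀ i, ∀ x ∈ E κ e, h i x = ∑ r, q r x * (f r i : ℝ)) := by
    intro κ e
    obtain ⟨v, qq, hv, hqq, hφeq⟩ := hEstruct κ e
    obtain ⟨hEs, hEo, hEsub⟩ := hE κ e
    have hEA : E κ e ⊆ A := fun x hx => (hEsub hx).1
    refine descent_piece hConst hEs hEo (fun i => (hW i).mono hEA hEs)
      (fun i => (hWd i).continuousOn.mono hEA) (fun i x hx => hWpos i x (hEA hx))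
      ((hh _).mono hEA hEs) (hγ_sa.mono hEA hEs) (hγ_d.continuousOn.mono hEA)
      (fun x hx => hpiv x (hEA hx)) (fun x hx => hrel x (hEA hx)) (fun t => f t.1 (κ t.1) t.2) v qq
      hv hqq (fun i x hx => hφeq i x hx) (fun t x hx => hfW t.1 (κ t.1) t.2 x ?_)
    exact (hRcell κ).2.2.2 t.1 (hEsub hx)
  -- assemble the family indexed by `Σ κ, Fin (N' κ)`
  refine descent_concl_of_family (J := Σ κ : ((j : Fin n) → Fin (N j)), Fin (N' κ))
    (fun p => E p.1 p.2)
    (fun p => ⟨(hE p.1 p.2).1, (hE p.1 p.2).2.1, fun x hx => ((hE p.1 p.2).2.2 hx).1⟩) ?_ ?_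
    fun p => hpiece p.1 p.2
  · rintro ⟨κ, e⟩ ⟨κ', e'⟩ hne
    by_cases hκ : κ = κ'
    · subst hκ
      have he : e ≠ e' := fun he => hne (by subst he; rfl)
      exact hEdisj κ he
    · exact Set.disjoint_of_subset (fun x hx => (hE κ e).2.2 hx) (fun x hx => (hE κ' e').2.2 hx)
        (hRdisj hκ)
  · have : (⋃ p : Σ κ : ((j : Fin n) → Fin (N j)), Fin (N' κ), E p.1 p.2) =
        ⋃ κ : (j : Fin n) → Fin (N j), (A ∩ ⋂ j, C j (κ j)) := by
      rw [Set.iUnion_sigma]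
      exact iUnion_congr fun κ => hEcov κ
    rw [this]
    exact hRnull

/-! ### The induction -/

/-- **The Kolchin–Ostrowski descent** (structure theorem for `ℚ`-semialgebraic log-linear
identities), by induction on the number of logarithms, from the peeling step and
constant-coefficient rigidity. [folklore] -/
theorem descent_main (hPeel : (∀ (n k : ℕ) (U : Set (Fin n → ℝ)) (φ W : Fin k → (Fin n → ℝ) → ℝ) (P γ : (Fin n → ℝ) → ℝ)
      (j : Fin n), IsSemialgebraic ℚ U → IsOpen U → (∀ i, IsSemialgebraicFunOn ℚ U (φ i)) →
      (∀ i, DifferentiableOn ℝ (φ i) U) → (∀ i, IsSemialgebraicFunOn ℚ U (W i)) →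
      (∀ i, DifferentiableOn ℝ (W i) U) → (∀ i, ∀ x ∈ U, 0 < W i x) → IsSemialgebraicFunOn ℚ U P →
      DifferentiableOn ℝ P U → (∀ x ∈ U, 0 < P x) → IsSemialgebraicFunOn ℚ U γ →
      DifferentiableOn ℝ γ U → (∀ x ∈ U, ∑ i, φ i x * Real.log (W i x) + Real.log (P x) = γ x) →
      (∀ i, IsSemialgebraicFunOn ℚ U (fun x => fderiv ℝ (φ i) x (Pi.single j (1 : ℝ)))) ∧
      IsSemialgebraicFunOn ℚ U (fun x => fderiv ℝ γ x (Pi.single j (1 : ℝ)) -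
        ∑ i, φ i x * fderiv ℝ (W i) x (Pi.single j (1 : ℝ)) / W i x -
        fderiv ℝ P x (Pi.single j (1 : ℝ)) / P x) ∧
      (∀ x ∈ U, ∑ i, fderiv ℝ (φ i) x (Pi.single j (1 : ℝ)) * Real.log (W i x) =
        fderiv ℝ γ x (Pi.single j (1 : ℝ)) -
        ∑ i, φ i x * fderiv ℝ (W i) x (Pi.single j (1 : ℝ)) / W i x -
        fderiv ℝ P x (Pi.single j (1 : ℝ)) / P x))) (hConst : (∀ (n k : ℕ) (D : Set (Fin n → ℝ)) (c : Fin k → ℝ) (W : Fin k → (Fin n → ℝ) → ℝ)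
      (G : (Fin n → ℝ) → ℝ), IsSemialgebraic ℚ D → IsOpen D → (∀ i, IsAlgebraic ℚ (c i)) →
      (∀ i, IsSemialgebraicFunOn ℚ D (W i)) → (∀ i, ContinuousOn (W i) D) →
      (∀ i, ∀ x ∈ D, 0 < W i x) → IsSemialgebraicFunOn ℚ D G → ContinuousOn G D →
      (∀ x ∈ D, ∑ i, c i * Real.log (W i x) = G x) →
      (∀ x ∈ D, G x = 0) ∧ ∃ (R : ℕ) (f : Fin R → Fin k → ℤ) (β : Fin R → ℝ),
        (∀ r, IsAlgebraic ℚ (β r)) ∧ (∀ r, ∀ x ∈ D, ∏ i, W i x ^ (f r i) = 1) ∧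
        (∀ i, c i = ∑ r, β r * (f r i : ℝ)))) (n : ℕ) :
    ∀ (k : ℕ) (U : Set (Fin n → ℝ)) (h W : Fin k → (Fin n → ℝ) → ℝ) (g : (Fin n → ℝ) → ℝ),
      IsSemialgebraic ℚ U → (∀ i, IsSemialgebraicFunOn ℚ U (h i)) →
      (∀ i, IsSemialgebraicFunOn ℚ U (W i)) → (∀ i, ∀ x ∈ U, 0 < W i x) →
      IsSemialgebraicFunOn ℚ U g → (∀ x ∈ U, ∑ i, h i x * Real.log (W i x) = g x) →
      ∃ (N : ℕ) (C : Fin N → Set (Fin n → ℝ)),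
        (∀ c, IsSemialgebraic ℚ (C c) ∧ IsOpen (C c) ∧ C c ⊆ U) ∧
        Pairwise (Function.onFun Disjoint C) ∧ volume (U \ ⋃ c, C c) = 0 ∧
        ∀ c, (∀ x ∈ C c, g x = 0) ∧
          ∃ (R : ℕ) (f : Fin R → Fin (k) → ℤ) (q : Fin R → (Fin n → ℝ) → ℝ),
            (∀ r, IsSemialgebraicFunOn ℚ (C c) (q r)) ∧
            (∀ r, ∀ x ∈ C c, ∏ i, W i x ^ (f r i) = 1) ∧
            (∀ i, ∀ x ∈ C c, h i x = ∑ r, q r x * (f r i : ℝ))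
  | 0, U, h, W, g => by
    intro hU hh hW hWpos hg hrel
    refine ⟨1, fun _ => interior U, fun _ => ⟨isSemialgebraic_interior hU, isOpen_interior,
      interior_subset⟩, Subsingleton.pairwise, ?_, fun _ => ⟨fun x hx => ?_, 0, fun r => r.elim0,
      fun r => r.elim0, fun r => r.elim0, fun r => r.elim0, fun i => i.elim0⟩⟩
    · rw [iUnion_const]
      exact descent_volume_diff_interior hU
    · have := hrel x (interior_subset hx)
      simpa using this.symm
  | k + 1, U, h, W, g => by
    intro hU hh hW hWpos hg hrel
    classical
    -- common smooth locus of `h, W, g`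
    set F : Fin ((k + 1) + (k + 1) + 1) → (Fin n → ℝ) → ℝ :=
      Fin.append (Fin.append h W) (fun _ => g) with hF
    have hFsa : ∀ m, IsSemialgebraicFunOn ℚ U (F m) := by
      intro m
      induction m using Fin.addCases with
      | left m₁ =>
        simp only [hF, Fin.append_left]
        induction m₁ using Fin.addCases with
        | left i => simp only [Fin.append_left]; exact hh i
        | right i => simp only [Fin.append_right]; exact hW i
      | right m₂ => simp only [hF, Fin.append_right]; exact hg
    obtain ⟨U₁, hU₁U, hU₁o, hU₁s, hU₁null, hsm⟩ := descent_smooth_locus hU _ F hFsa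
    have h1le : (∞ : WithTop ℕ∞) ≠ 0 := by simp
    have hh_d : ∀ i, DifferentiableOn ℝ (h i) U₁ := fun i => by
      have := hsm (Fin.castAdd 1 (Fin.castAdd (k + 1) i))
      simp only [hF, Fin.append_left] at this
      exact this.differentiableOn h1le
    have hW_d : ∀ i, DifferentiableOn ℝ (W i) U₁ := fun i => by
      have := hsm (Fin.castAdd 1 (Fin.natAdd (k + 1) i))
      simp only [hF, Fin.append_left, Fin.append_right] at this
      exact this.differentiableOn h1le
    have hg_d : DifferentiableOn ℝ g U₁ := by
      have := hsm (Fin.natAdd ((k + 1) + (k + 1)) 0)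
      simp only [hF, Fin.append_right] at this
      exact this.differentiableOn h1le
    -- split `U₁` along the zero set `Z` of the pivot
    set Z : Set (Fin n → ℝ) := {x | x ∈ U₁ ∧ h (Fin.last k) x = 0} with hZ
    have hZs : IsSemialgebraic ℚ Z := by
      have := isSemialgebraic_sep_eq ((hh (Fin.last k)).mono hU₁U hU₁s)
        (isSemialgebraicFunOn_ratCast hU₁s 0)
      simpa [hZ] using this
    set A : Set (Fin n → ℝ) := U₁ \ Z with hAdef
    set B : Set (Fin n → ℝ) := interior Z with hBdef
    have hAU₁ : A ⊆ U₁ := sdiff_subset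
    have hBU₁ : B ⊆ U₁ := fun x hx => (interior_subset (s := Z) hx).1
    have hAs : IsSemialgebraic ℚ A := hU₁s.diff hZs
    have hBs : IsSemialgebraic ℚ B := isSemialgebraic_interior hZs
    have hAeq : A = U₁ ∩ (h (Fin.last k)) ⁻¹' ({0}ᶜ) := by
      ext x
      simp only [hAdef, hZ, mem_sdiff, mem_setOf_eq, mem_inter_iff, mem_preimage, mem_compl_iff,
        mem_singleton_iff, not_and]
      exact ⟨fun hx => ⟨hx.1, hx.2 hx.1⟩, fun hx => ⟨hx.1, fun _ => hx.2⟩⟩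
    have hAo : IsOpen A := by
      rw [hAeq]
      exact (hh_d (Fin.last k)).continuousOn.isOpen_inter_preimage hU₁o isOpen_compl_singleton
    have hpiv : ∀ x ∈ A, h (Fin.last k) x ≠ 0 := fun x hx h0 => hx.2 ⟨hx.1, h0⟩
    have hB0 : ∀ x ∈ B, h (Fin.last k) x = 0 := fun x hx => (interior_subset (s := Z) hx).2
    -- step A on `A`
    obtain ⟨NA, CA, hCA, hCAdisj, hCAnull, hCAcell⟩ :=
      descent_stepA hPeel hConst (fun U' h' W' g' => descent_main hPeel hConst n k U' h' W' g') hAs hAo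
        (fun i => (hh i).mono (hAU₁.trans hU₁U) hAs) (fun i => (hh_d i).mono hAU₁)
        (fun i => (hW i).mono (hAU₁.trans hU₁U) hAs) (fun i => (hW_d i).mono hAU₁)
        (fun i x hx => hWpos i x (hU₁U (hAU₁ hx))) (hg.mono (hAU₁.trans hU₁U) hAs)
        (hg_d.mono hAU₁) hpiv (fun x hx => hrel x (hU₁U (hAU₁ hx)))
    -- step B on `B`
    have hcB := descent_main hPeel hConst n k B (fun i => h (Fin.castSucc i))
      (fun i => W (Fin.castSucc i)) g hBs (fun i => (hh _).mono (hBU₁.trans hU₁U) hBs)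
      (fun i => (hW _).mono (hBU₁.trans hU₁U) hBs) (fun i x hx => hWpos _ x (hU₁U (hBU₁ hx)))
      (hg.mono (hBU₁.trans hU₁U) hBs) (fun x hx => by
        have := hrel x (hU₁U (hBU₁ hx))
        rw [Fin.sum_univ_castSucc, hB0 x hx, zero_mul, add_zero] at this
        exact this)
    obtain ⟨NB, CB, hCB, hCBdisj, hCBnull, hCBcell⟩ := descent_stepB hB0 hcB
    -- assemble
    refine descent_concl_of_family (J := Fin NA ⊕ Fin NB) (Sum.elim CA CB) ?_ ?_ ?_ ?_
    · rintro (c | c)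
      · exact ⟨(hCA c).1, (hCA c).2.1, ((hCA c).2.2.trans hAU₁).trans hU₁U⟩
      · exact ⟨(hCB c).1, (hCB c).2.1, ((hCB c).2.2.trans hBU₁).trans hU₁U⟩
    · have hAB : Disjoint A B := by
        rw [Set.disjoint_iff]
        rintro x ⟨hxA, hxB⟩
        exact hxA.2 (interior_subset (s := Z) hxB)
      rintro (c | c) (c' | c') hne
      · exact hCAdisj fun h => hne (congr_arg Sum.inl h)
      · exact Set.disjoint_of_subset (hCA c).2.2 (hCB c').2.2 hAB
      · exact Set.disjoint_of_subset (hCB c).2.2 (hCA c').2.2 hAB.symm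
      · exact hCBdisj fun h => hne (congr_arg Sum.inr h)
    · have hcov : U \ ⋃ c, Sum.elim CA CB c ⊆
          (U \ U₁) ∪ (Z \ interior Z) ∪ (A \ ⋃ c, CA c) ∪ (B \ ⋃ c, CB c) := by
        intro x hx
        have hxnot : ∀ c, x ∉ Sum.elim CA CB c := fun c hc => hx.2 (mem_iUnion.2 ⟨c, hc⟩)
        by_cases hx1 : x ∈ U₁
        · by_cases hxZ : x ∈ Z
          · by_cases hxB : x ∈ B
            · refine Or.inr ⟨hxB, fun hx' => ?_⟩
              obtain ⟨c, hc⟩ := mem_iUnion.1 hx'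
              exact hxnot (Sum.inr c) hc
            · exact Or.inl (Or.inl (Or.inr ⟨hxZ, hxB⟩))
          · refine Or.inl (Or.inr ⟨⟨hx1, hxZ⟩, fun hx' => ?_⟩)
            obtain ⟨c, hc⟩ := mem_iUnion.1 hx'
            exact hxnot (Sum.inl c) hc
        · exact Or.inl (Or.inl (Or.inl ⟨hx.1, hx1⟩))
      exact measure_mono_null hcov (measure_union_null (measure_union_null
        (measure_union_null hU₁null (descent_volume_diff_interior hZs)) hCAnull) hCBnull)
    · rintro (c | c)
      · exact hCAcell c
      · exact hCBcell c

/-- **Log-linear descent** (registered stub `stub_descent` of line `logderiv-peeling` for the crux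
`LogPrimitiveNL`): from the peeling step and constant-coefficient rigidity, the structure theorem for
`ℚ`-semialgebraic log-linear identities `Σ hᵢ log Wᵢ = g` on a `ℚ`-semialgebraic `U`: finitely many
disjoint open semialgebraic cells covering `U` up to a null set, on each of which `g ≡ 0` and
`h = Σ_r q_r f_r` with `q_r` `ℚ`-semialgebraic and exact multiplicative relations `∏ Wᵢ^{f_r i} ≡ 1`
(Kolchin–Ostrowski induction on `k` along the base). [folklore] -/
theorem stub_descent :
    (∀ (n k : ℕ) (U : Set (Fin n → ℝ)) (φ W : Fin k → (Fin n → ℝ) → ℝ) (P γ : (Fin n → ℝ) → ℝ)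
      (j : Fin n), IsSemialgebraic ℚ U → IsOpen U → (∀ i, IsSemialgebraicFunOn ℚ U (φ i)) →
      (∀ i, DifferentiableOn ℝ (φ i) U) → (∀ i, IsSemialgebraicFunOn ℚ U (W i)) →
      (∀ i, DifferentiableOn ℝ (W i) U) → (∀ i, ∀ x ∈ U, 0 < W i x) → IsSemialgebraicFunOn ℚ U P →
      DifferentiableOn ℝ P U → (∀ x ∈ U, 0 < P x) → IsSemialgebraicFunOn ℚ U γ →
      DifferentiableOn ℝ γ U → (∀ x ∈ U, ∑ i, φ i x * Real.log (W i x) + Real.log (P x) = γ x) →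
      (∀ i, IsSemialgebraicFunOn ℚ U (fun x => fderiv ℝ (φ i) x (Pi.single j (1 : ℝ)))) ∧
      IsSemialgebraicFunOn ℚ U (fun x => fderiv ℝ γ x (Pi.single j (1 : ℝ)) -
        ∑ i, φ i x * fderiv ℝ (W i) x (Pi.single j (1 : ℝ)) / W i x -
        fderiv ℝ P x (Pi.single j (1 : ℝ)) / P x) ∧
      (∀ x ∈ U, ∑ i, fderiv ℝ (φ i) x (Pi.single j (1 : ℝ)) * Real.log (W i x) =
        fderiv ℝ γ x (Pi.single j (1 : ℝ)) -
        ∑ i, φ i x * fderiv ℝ (W i) x (Pi.single j (1 : ℝ)) / W i x -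
        fderiv ℝ P x (Pi.single j (1 : ℝ)) / P x)) →
    (∀ (n k : ℕ) (D : Set (Fin n → ℝ)) (c : Fin k → ℝ) (W : Fin k → (Fin n → ℝ) → ℝ)
      (G : (Fin n → ℝ) → ℝ), IsSemialgebraic ℚ D → IsOpen D → (∀ i, IsAlgebraic ℚ (c i)) →
      (∀ i, IsSemialgebraicFunOn ℚ D (W i)) → (∀ i, ContinuousOn (W i) D) →
      (∀ i, ∀ x ∈ D, 0 < W i x) → IsSemialgebraicFunOn ℚ D G → ContinuousOn G D →
      (∀ x ∈ D, ∑ i, c i * Real.log (W i x) = G x) →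
      (∀ x ∈ D, G x = 0) ∧ ∃ (R : ℕ) (f : Fin R → Fin k → ℤ) (β : Fin R → ℝ),
        (∀ r, IsAlgebraic ℚ (β r)) ∧ (∀ r, ∀ x ∈ D, ∏ i, W i x ^ (f r i) = 1) ∧
        (∀ i, c i = ∑ r, β r * (f r i : ℝ))) →
    ∀ (n k : ℕ) (U : Set (Fin n → ℝ)) (h W : Fin k → (Fin n → ℝ) → ℝ) (g : (Fin n → ℝ) → ℝ),
      IsSemialgebraic ℚ U → (∀ i, IsSemialgebraicFunOn ℚ U (h i)) →
      (∀ i, IsSemialgebraicFunOn ℚ U (W i)) → (∀ i, ∀ x ∈ U, 0 < W i x) →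
      IsSemialgebraicFunOn ℚ U g → (∀ x ∈ U, ∑ i, h i x * Real.log (W i x) = g x) →
      ∃ (N : ℕ) (C : Fin N → Set (Fin n → ℝ)),
        (∀ c, IsSemialgebraic ℚ (C c) ∧ IsOpen (C c) ∧ C c ⊆ U) ∧
        Pairwise (Function.onFun Disjoint C) ∧ volume (U \ ⋃ c, C c) = 0 ∧
        ∀ c, (∀ x ∈ C c, g x = 0) ∧
          ∃ (R : ℕ) (f : Fin R → Fin k → ℤ) (q : Fin R → (Fin n → ℝ) → ℝ),
            (∀ r, IsSemialgebraicFunOn ℚ (C c) (q r)) ∧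
            (∀ r, ∀ x ∈ C c, ∏ i, W i x ^ (f r i) = 1) ∧
            (∀ i, ∀ x ∈ C c, h i x = ∑ r, q r x * (f r i : ℝ)) :=
  fun hPeel hConst n k U h W g => descent_main hPeel hConst n k U h W g

end Summit.KontsevichZagierPeriods.LiouvilleUnfolding.LogPrimitiveNL

end
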